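import Mathlib
import Summits.ResolutionOfSingularities.ResolutionOfSingularities.Theorems.HomologicalConductorPersistenceAuslanderAddCover
import Summits.ResolutionOfSingularities.ResolutionOfSingularities.Theorems.HomologicalConductorPersistenceCyclicQuotientSurfaceFinite
import HarnessLib

/-!
# Rung S-2 `PersistenceSurface` (stmt-19970), stub C1 (`Sat₄`) — AUSLANDER–HERZOG AT THE CYCLIC QUOTIENT SURFACE
# `U = k[u,v]^{μ_n(1,q)}`: `Ω²(mod U) ⊆ add_U k[u,v]` with NO hypotheses left, and the two-decomposition
# `Sat₄` certificate shape (chain W4.4b, seat res-L1-w44b-stub-4 gen 6; T-V package part 16)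

[OURS · L1 w44b · rung S-2] Nothing here is a statement of the manuscript under review (Hironaka 2017);
AI-written, weaker than expert review.

Part 15 (`…PersistenceAuslanderAddCover`) proved Herzog's lemma `Ω²(mod U) ⊆ add_U (V|_U)` for an algebra
`U → V` under three hypotheses — a `U`-linear retraction `ρ` of the structure map, the Frobenius hypothesis
«`Hom_U(V, U)` finitely generated projective over `V`», and `1 ∈ ca³(V)` — and turned two explicit syzygy
decompositions into `ca(U) = ca⁴(U) = s̲ann(D)`.  This file discharges the three hypotheses at the toric surface
stages of the S-2 ledger, `V = k[u,v] ⊇ U = V^{μ_n}`, `μ_n` acting by `u ↦ ζu`, `v ↦ ζ^q v` (`ζ` a primitive `n`-th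
root of unity in `k`, `n ∈ kˣ`, `gcd(q, n) = 1`; the setting of parts 13–14):

* `exists_standardData` — the STANDARD DATA of parts 8–13 packaged once as a reusable statement (it was so far
  buried inside the proof of part 13's law): the action `σ : μ_n →* (V →ₐ[U] V)` with fixed ring `U`, the
  bicharacter `χ x g = ζ^{xg}` with both multiplicativities and second orthogonality, `|μ_n| ∈ Uˣ`, (BIG) at every
  height-one prime (`u^t` or `v^s` avoids it), nonvanishing of every isotypic piece, and the dictionary
  `σ (ofAdd a) = σ₀^{a}`.
* `exists_reynolds_cyclicQuotient` — a Reynolds operator `ρ : V →ₗ[U] U`, `ρ ∘ algebraMap = id`;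
  `finite_projective_coind_cyclicQuotient` — the Frobenius hypothesis (part 11, from normality of `k[u,v]` + (BIG)).
* **`isRetractOfPower_of_isSyzygy_two_cyclicQuotient`** — AUSLANDER–HERZOG for `1/n(1,q)`, hypothesis-free:
  every second syzygy module of a finitely generated `U`-module is a `U`-direct summand of some `k[u,v]ᵐ`
  (`1 ∈ ca³(k[u,v])` by the tree's `cohomologyAnnihilatorOfDegree_mvPolynomial_eq_top`);
  `isRetractOfPower_of_isSyzygy_three_cyclicQuotient` — `Ω³(mod U) ⊆ add_U (Ω(k[u,v]|_U) ⊕ U)`.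
* **`cohomologyAnnihilator_eq_four_cyclicQuotient`** — THE `Sat₄` CERTIFICATE SHAPE at `1/n(1,q)`: a first
  `U`-syzygy `K_V` of `k[u,v]|_U` with `K_V ∈ add (D ⊕ U)` and a first syzygy `K_D` of a finitely generated `D` with
  `D ∈ add (K_D ⊕ U)` give **`ca(U) = ca⁴(U)` and `x ∈ ca(U) ↔ x ∈ s̲ann(D)`** (levelled: `caᵐ(U) = ca⁴(U)`,
  `m ≥ 4`).  By res-L1-w44b-idea-1's SC-TORIC §2(e) the intended data are `D = ⊕_t M_{n−i_t}` (`i_t` the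
  `i`-series of `n/q`), `Ω M_χ ≅ ⊕_{d ∈ greedy(χ)} M_{n−d}` (so `K_V ∈ add (D ⊕ U)`) and the block lemma
  (`D ∈ add (Ω D ⊕ U)`); with the rank-one trace dictionary `s̲ann(M_ψ) = M_ψ M_{−ψ}`
  (`…RecurrenceTraceCeiling.stablyAnnihilates_ideal_iff_mem_mul_inv`) the conclusion reads
  `ca(U) = ca⁴(U) = ⋂_t M_{i_t}·M_{n−i_t}` — `SaturationCompleteRationalNormal` with equality on the whole cyclic
  class, ONE pair of explicit monomial matrices per `(n, q)` away from the kernel.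

References: Iyengar–Takahashi, IMRN 2016, arXiv:1404.1476, §2 [`IyengarTakahashi2014`]; M. Auslander, Trans. AMS
293 (1986); J. Herzog, Math. Ann. 233 (1978) — mechanism only; O. Iyama, M. Wemyss, Math. Z. 265 (2010),
arXiv:0809.1958, Cor. 2.9 (names `D`; not used in proofs).
-/

-- single-problem summit: the doubled namespace component `ResolutionOfSingularities` is forced
set_option linter.dupNamespace false

noncomputable section

open CategoryTheory Literature.RingTheory.CohomologyAnnihilator MvPolynomial
open Summit.ResolutionOfSingularities.ResolutionOfSingularities.Theorems.NoZeno.SandwichCluster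
open Summit.ResolutionOfSingularities.ResolutionOfSingularities.Theorems.HomologicalConductor.PersistenceCyclicTransferFamily
open Summit.ResolutionOfSingularities.ResolutionOfSingularities.Theorems.HomologicalConductor.PersistenceCyclicTransferAbelianBicharacter
open Summit.ResolutionOfSingularities.ResolutionOfSingularities.Theorems.HomologicalConductor.PersistenceCyclicTransferAbelianCoinduced
open Summit.ResolutionOfSingularities.ResolutionOfSingularities.Theorems.HomologicalConductor.PersistenceCyclicTransferAbelianPairing
open Summit.ResolutionOfSingularities.ResolutionOfSingularities.Theorems.HomologicalConductor.PersistenceCyclicQuotientSurface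
open Summit.ResolutionOfSingularities.ResolutionOfSingularities.Theorems.HomologicalConductor.PersistenceCyclicQuotientSurfaceFinite
open Summit.ResolutionOfSingularities.ResolutionOfSingularities.Theorems.HomologicalConductor.PersistenceAuslanderAddCover

universe u

namespace Summit.ResolutionOfSingularities.ResolutionOfSingularities.Theorems.HomologicalConductor.PersistenceCyclicQuotientAddCover

variable {k : Type u} [Field k] {n : ℕ} [NeZero n] {ζ : k} (hζ : IsPrimitiveRoot ζ n) (hn : (n : k) ≠ 0)
variable {q : ℕ} (hq : q.Coprime n) (U : Subalgebra k (MvPolynomial (Fin 2) k))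
variable (hU : ∀ p, p ∈ U ↔ aeval (fun i : Fin 2 => C (ζ ^ (![1, q] : Fin 2 → ℕ) i) * X i) p = p)

/-! ## The standard data of `1/n(1,q)` as a reusable statement -/

include hζ hn hq hU in
/-- **The standard data of the cyclic quotient surface `1/n(1,q)`** (parts 8–13, packaged): the action
`σ : μ_n →* (k[u,v] →ₐ[U] k[u,v])`, `σ (ofAdd a) = σ₀^{a}`, with fixed ring `U`; the bicharacter
`χ x g = ζ^{x·g} ∈ U`, multiplicative in both variables, `χ 1 g = χ x 1 = 1`, with second orthogonality
`∑_x χ x g = 0` (`g ≠ 1`); `|μ_n| ∈ Uˣ`; (BIG): for every `x` and every height-one prime `P ⊂ k[u,v]` some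
semi-invariant of character `χ x` avoids `P`; and every isotypic piece is nonzero. [OURS · L1 w44b] -/
theorem exists_standardData :
    ∃ (σ : Multiplicative (ZMod n) →* (MvPolynomial (Fin 2) k →ₐ[U] MvPolynomial (Fin 2) k))
      (χ : Multiplicative (ZMod n) → Multiplicative (ZMod n) → U),
      (∀ (a : ZMod n) (p : MvPolynomial (Fin 2) k), σ (Multiplicative.ofAdd a) p =
        ((aeval (fun i : Fin 2 => C (ζ ^ (![1, q] : Fin 2 → ℕ) i) * X i) : _ →ₐ[k] _) ^ a.val) p) ∧
      (∀ v, (∀ g, σ g v = v) → ∃ u : U, algebraMap U (MvPolynomial (Fin 2) k) u = v) ∧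
      (∀ x g, algebraMap U (MvPolynomial (Fin 2) k) (χ x g) =
        C (ζ ^ ((Multiplicative.toAdd x).val * (Multiplicative.toAdd g).val))) ∧
      (∀ g, χ 1 g = 1) ∧ (∀ x x' g, χ (x * x') g = χ x g * χ x' g) ∧ (∀ x, χ x 1 = 1) ∧
      (∀ x g h, χ x (g * h) = χ x g * χ x h) ∧ (∀ g, g ≠ 1 → ∑ x, χ x g = 0) ∧
      IsUnit ((Fintype.card (Multiplicative (ZMod n)) : ℕ) : U) ∧
      (∀ (x : Multiplicative (ZMod n)) (P : Ideal (MvPolynomial (Fin 2) k)), P.IsPrime → P.height = 1 →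
        ∃ m : MvPolynomial (Fin 2) k, (∀ g, σ g m = algebraMap U _ (χ x g) * m) ∧ m ∉ P) ∧
      (∀ x : Multiplicative (ZMod n), ∃ m : MvPolynomial (Fin 2) k,
        (∀ g, σ g m = algebraMap U _ (χ x g) * m) ∧ m ≠ 0) := by
  classical
  set V := MvPolynomial (Fin 2) k
  set σ₀ := aeval (R := k) (fun i : Fin 2 => C (ζ ^ (![1, q] : Fin 2 → ℕ) i) * X i) with hσ₀
  obtain ⟨σ, hσ, hfix⟩ := exists_action hζ q U hU
  have hζn : ζ ^ n = 1 := hζ.pow_eq_one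
  let χ : Multiplicative (ZMod n) → Multiplicative (ZMod n) → U :=
    fun x g => algebraMap k U (ζ ^ ((Multiplicative.toAdd x).val * (Multiplicative.toAdd g).val))
  have hχval : ∀ x g, algebraMap U V (χ x g) =
      C (ζ ^ ((Multiplicative.toAdd x).val * (Multiplicative.toAdd g).val)) := fun x g => rfl
  have hχmod : ∀ {a b : ℕ}, a ≡ b [MOD n] → ζ ^ a = ζ ^ b := fun h => pow_eq_pow_of_modEq hζn h
  have hχone₁ : ∀ g, χ 1 g = 1 := fun g => by simp [χ]
  have hχone₂ : ∀ x, χ x 1 = 1 := fun x => by simp [χ]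
  have hχmul₁ : ∀ x x' g, χ (x * x') g = χ x g * χ x' g := fun x x' g => by
    simp only [χ, toAdd_mul, ← map_mul, ← pow_add, ← add_mul]
    congr 1; apply hχmod
    rw [ZMod.val_add]
    exact (Nat.mod_modEq _ _).mul_right _
  have hχmul₂ : ∀ x g h, χ x (g * h) = χ x g * χ x h := fun x g h => by
    simp only [χ, toAdd_mul, ← map_mul, ← pow_add, ← mul_add]
    congr 1; apply hχmod
    rw [ZMod.val_add]
    exact (Nat.mod_modEq _ _).mul_left _
  have horth : ∀ g : Multiplicative (ZMod n), g ≠ 1 → ∑ x, χ x g = 0 := fun g hg => by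
    simp only [χ, ← map_sum]
    rw [sum_pow_val_mul_val_eq_zero (sum_pow_mul_eq_zero_of_isPrimitiveRoot hζ) g hg, map_zero]
  have hGU : IsUnit ((Fintype.card (Multiplicative (ZMod n)) : ℕ) : U) := by
    rw [Fintype.card_multiplicative, ZMod.card]
    have : ((n : ℕ) : U) = algebraMap k U n := by rw [map_natCast]
    rw [this]
    exact (IsUnit.mk0 _ hn).map _
  have hCm : ∀ (m : ℕ) (a : k), (σ₀ ^ m) (C a) = C a := fun m a => (σ₀ ^ m).commutes a
  -- characters of monomials under `σ`
  have hσmon : ∀ (g : Multiplicative (ZMod n)) (d : Fin 2 →₀ ℕ) (c : k),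
      σ g (monomial d c) = C (ζ ^ ((d 0 + q * d 1) * (Multiplicative.toAdd g).val)) * monomial d c := by
    intro g d c
    rw [show g = Multiplicative.ofAdd (Multiplicative.toAdd g) from rfl, hσ, toAdd_ofAdd]
    generalize (Multiplicative.toAdd g).val = m
    induction m with
    | zero => simp
    | succ m ih =>
      rw [pow_succ, AlgHom.mul_apply, ← hσ₀, rootAut_monomial, map_mul, ih, hCm, ← mul_assoc, ← C_mul, ← pow_add,
        show d 0 + q * d 1 + (d 0 + q * d 1) * m = (d 0 + q * d 1) * (m + 1) by ring]
  -- (BIG)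
  have hbig : ∀ (x : Multiplicative (ZMod n)) (P : Ideal V), P.IsPrime → P.height = 1 →
      ∃ m : V, (∀ g, σ g m = algebraMap U V (χ x g) * m) ∧ m ∉ P := by
    intro x P hP hP1
    set t := (Multiplicative.toAdd x).val
    let qu : (ZMod n)ˣ := ZMod.unitOfCoprime q hq
    set s := ((qu⁻¹ : (ZMod n)ˣ) * Multiplicative.toAdd x : ZMod n).val with hs
    have hqs : q * s ≡ t [MOD n] := by
      rw [← ZMod.natCast_eq_natCast_iff, Nat.cast_mul, hs, ZMod.natCast_val, ZMod.cast_id', id, ← mul_assoc,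
        show ((q : ℕ) : ZMod n) = (qu : ZMod n) from (ZMod.coe_unitOfCoprime q hq).symm, Units.mul_inv, one_mul,
        ZMod.natCast_val, ZMod.cast_id', id]
    have hu : ∀ g, σ g (X 0 ^ t) = algebraMap U V (χ x g) * X 0 ^ t := fun g => by
      rw [hχval, show (X 0 ^ t : V) = monomial (Finsupp.single 0 t) 1 by rw [X_pow_eq_monomial], hσmon]
      simp [t]
    have hv : ∀ g, σ g (X 1 ^ s) = algebraMap U V (χ x g) * X 1 ^ s := fun g => by
      rw [hχval, show (X 1 ^ s : V) = monomial (Finsupp.single 1 s) 1 by rw [X_pow_eq_monomial], hσmon]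
      simp only [Finsupp.single_apply, Fin.one_eq_zero_iff, OfNat.ofNat_ne_one, if_false, zero_add, if_true]
      rw [pow_eq_pow_of_modEq hζn (hqs.mul_right _)]
    by_contra hcon
    push Not at hcon
    have h0 : (X 0 : V) ^ t ∈ P := hcon _ hu
    have h1 : (X 1 : V) ^ s ∈ P := hcon _ hv
    exact not_X_mem_and_X_mem hP hP1 ⟨hP.mem_of_pow_mem _ h0, hP.mem_of_pow_mem _ h1⟩
  -- nonvanishing of every isotypic piece: `u^t`
  have hne : ∀ x : Multiplicative (ZMod n), ∃ m : V, (∀ g, σ g m = algebraMap U V (χ x g) * m) ∧ m ≠ 0 := by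
    intro x
    refine ⟨X 0 ^ (Multiplicative.toAdd x).val, fun g => ?_, pow_ne_zero _ (X_ne_zero 0)⟩
    rw [hχval, show (X 0 ^ (Multiplicative.toAdd x).val : V) = monomial (Finsupp.single 0 _) 1 by
      rw [X_pow_eq_monomial], hσmon]
    simp
  exact ⟨σ, χ, hσ, hfix, hχval, hχone₁, hχmul₁, hχone₂, hχmul₂, horth, hGU, hbig, hne⟩

/-! ## Reynolds operator and Frobenius hypothesis at `1/n(1,q)` -/

include hζ hn hq hU in
/-- **Reynolds operator of `μ_n(1,q)`**: a `U`-linear `ρ : k[u,v] → U` with `ρ ∘ algebraMap = id`. [folklore] -/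
theorem exists_reynolds_cyclicQuotient :
    ∃ ρ : MvPolynomial (Fin 2) k →ₗ[U] U, ∀ u, ρ (algebraMap U (MvPolynomial (Fin 2) k) u) = u := by
  obtain ⟨σ, χ, -, hfix, -, -, -, -, -, -, hGU, -, -⟩ := exists_standardData hζ hn hq U hU
  obtain ⟨ρ, hρalg, -, -⟩ := exists_reynolds_group σ hfix Subtype.val_injective hGU
  exact ⟨ρ, hρalg⟩

include hζ hn hq hU in
/-- **The Frobenius hypothesis at `1/n(1,q)`**: `Hom_U(k[u,v], U)` is a finitely generated projective
`k[u,v]`-module (part 11: normality of `k[u,v]` + (BIG) + orthogonality). [folklore] -/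
theorem finite_projective_coind_cyclicQuotient :
    Module.Finite (MvPolynomial (Fin 2) k)
        (((ModuleCat.restrictScalars (algebraMap U (MvPolynomial (Fin 2) k))).obj
          (ModuleCat.of (MvPolynomial (Fin 2) k) (MvPolynomial (Fin 2) k))) →ₗ[U] U) ∧
      Module.Projective (MvPolynomial (Fin 2) k)
        (((ModuleCat.restrictScalars (algebraMap U (MvPolynomial (Fin 2) k))).obj
          (ModuleCat.of (MvPolynomial (Fin 2) k) (MvPolynomial (Fin 2) k))) →ₗ[U] U) := by
  classical
  obtain ⟨σ, χ, -, hfix, -, -, -, hχone₂, hχmul₂, horth, hGU, hbig, -⟩ := exists_standardData hζ hn hq U hU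
  exact finite_projective_coind_of_isIntegrallyClosed_group σ hfix Subtype.val_injective χ hχone₂ hχmul₂ horth
    hGU hGU hbig

/-! ## Auslander–Herzog at `1/n(1,q)`, hypothesis-free -/

include hζ hn hq hU in
/-- **AUSLANDER–HERZOG for the cyclic quotient surface `U = k[u,v]^{μ_n(1,q)}`** (`ζ` a primitive `n`-th root of
unity in `k`, `n ∈ kˣ`, `gcd(q,n) = 1`): every second syzygy module of a finitely generated `U`-module is a
`U`-direct summand of `k[u,v]ᵐ|_U` for some `m` — `Ω²(mod U) ⊆ add_U k[u,v]` («`CM(1/n(1,q)) = add k[u,v]`» in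
syzygy language), with every hypothesis of part 15's Herzog lemma discharged. [OURS · L1 w44b] -/
theorem isRetractOfPower_of_isSyzygy_two_cyclicQuotient (M K : ModuleCat.{u} U) (hM : Module.Finite U M)
    (hK : IsSyzygy 2 M K) :
    IsRetractOfPower ((restrictScalarsFunctor U (MvPolynomial (Fin 2) k)).obj
      (ModuleCat.of (MvPolynomial (Fin 2) k) (MvPolynomial (Fin 2) k))) K := by
  obtain ⟨ρ, hρ⟩ := exists_reynolds_cyclicQuotient hζ hn hq U hU
  obtain ⟨hfin, hproj⟩ := finite_projective_coind_cyclicQuotient hζ hn hq U hU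
  haveI := hfin
  haveI := hproj
  have hV : (1 : MvPolynomial (Fin 2) k) ∈ cohomologyAnnihilatorOfDegree (MvPolynomial (Fin 2) k) 3 := by
    rw [cohomologyAnnihilatorOfDegree_mvPolynomial_eq_top k 2]
    exact Submodule.mem_top
  exact isRetractOfPower_restrictScalars_of_isSyzygy_two ρ (by simpa using hρ 1) hV M K hM hK

include hζ hn hq hU in
/-- **`Ω³(mod U) ⊆ add_U (Ω(k[u,v]|_U) ⊕ U)` at `1/n(1,q)`**, for any first `U`-syzygy module `K_V` of `k[u,v]|_U`
(e.g. `⊕_χ Ω M_χ`). [OURS · L1 w44b] -/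
theorem isRetractOfPower_of_isSyzygy_three_cyclicQuotient {KV : ModuleCat.{u} U}
    (hKV : IsSyzygy 1 ((restrictScalarsFunctor U (MvPolynomial (Fin 2) k)).obj
      (ModuleCat.of (MvPolynomial (Fin 2) k) (MvPolynomial (Fin 2) k))) KV)
    (M K : ModuleCat.{u} U) (hM : Module.Finite U M) (hK : IsSyzygy 3 M K) :
    IsRetractOfPower (ModuleCat.of U (KV × U)) K :=
  isRetractOfPower_of_isSyzygy_succ_of_cover (isRetractOfPower_of_isSyzygy_two_cyclicQuotient hζ hn hq U hU) hKV hM hK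

/-! ## The `Sat₄` certificate shape at `1/n(1,q)` -/

include hζ hn hq hU in
/-- **`Sat₄` AND THE EXACT CENTRE AT `1/n(1,q)` FROM TWO DECOMPOSITIONS.**  Let `K_V` be a first `U`-syzygy module
of `k[u,v]|_U` lying in `add (D ⊕ U)` for a finitely generated `U`-module `D`, and `K_D` a first syzygy module of
`D` with `D ∈ add (K_D ⊕ U)`.  Then `ca(U) = ca⁴(U)` and `x ∈ ca(U) ↔ x ∈ s̲ann(D)`.  (Intended: `D = ⊕_t M_{n−i_t}`;
then `s̲ann(D) = ⋂_t M_{i_t}M_{n−i_t}`.) [OURS · L1 w44b] -/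
theorem cohomologyAnnihilator_eq_four_cyclicQuotient {KV D KD : ModuleCat.{u} U} [Module.Finite U D]
    (hKV : IsSyzygy 1 ((restrictScalarsFunctor U (MvPolynomial (Fin 2) k)).obj
      (ModuleCat.of (MvPolynomial (Fin 2) k) (MvPolynomial (Fin 2) k))) KV)
    (hKVD : IsRetractOfPower (ModuleCat.of U (D × U)) KV)
    (hKD : IsSyzygy 1 D KD) (hD : IsRetractOfPower (ModuleCat.of U (KD × U)) D) :
    cohomologyAnnihilator U = cohomologyAnnihilatorOfDegree U 4 ∧
      ∀ x : U, x ∈ cohomologyAnnihilator U ↔ StablyAnnihilates U x D := by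
  haveI := isNoetherianRing_cyclicQuotient hζ hn q U hU
  exact ⟨cohomologyAnnihilator_eq_of_cover_of_omegaStable 2
      (isRetractOfPower_of_isSyzygy_two_cyclicQuotient hζ hn hq U hU) hKV hKVD hKD hD,
    mem_cohomologyAnnihilator_iff_stablyAnnihilates_of_cover_of_omegaStable 2
      (isRetractOfPower_of_isSyzygy_two_cyclicQuotient hζ hn hq U hU) hKV hKVD hKD hD⟩

include hζ hn hq hU in
/-- Levelled form: under the same two decompositions `caᵐ(U) = ca⁴(U)` for every `m ≥ 4`, and
`x ∈ ca⁴(U) ↔ x ∈ s̲ann(D)`. [OURS · L1 w44b] -/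
theorem cohomologyAnnihilatorOfDegree_eq_four_cyclicQuotient {KV D KD : ModuleCat.{u} U} [Module.Finite U D]
    (hKV : IsSyzygy 1 ((restrictScalarsFunctor U (MvPolynomial (Fin 2) k)).obj
      (ModuleCat.of (MvPolynomial (Fin 2) k) (MvPolynomial (Fin 2) k))) KV)
    (hKVD : IsRetractOfPower (ModuleCat.of U (D × U)) KV)
    (hKD : IsSyzygy 1 D KD) (hD : IsRetractOfPower (ModuleCat.of U (KD × U)) D) {m : ℕ} (hm : 4 ≤ m) :
    cohomologyAnnihilatorOfDegree U m = cohomologyAnnihilatorOfDegree U 4 ∧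
      ∀ x : U, x ∈ cohomologyAnnihilatorOfDegree U 4 ↔ StablyAnnihilates U x D := by
  haveI := isNoetherianRing_cyclicQuotient hζ hn q U hU
  exact ⟨cohomologyAnnihilatorOfDegree_eq_of_cover_of_omegaStable 2
      (isRetractOfPower_of_isSyzygy_two_cyclicQuotient hζ hn hq U hU) hKV hKVD hKD hD hm,
    mem_cohomologyAnnihilatorOfDegree_iff_stablyAnnihilates_of_cover_of_omegaStable 2
      (isRetractOfPower_of_isSyzygy_two_cyclicQuotient hζ hn hq U hU) hKV hKVD hKD hD⟩

end Summit.ResolutionOfSingularities.ResolutionOfSingularities.Theorems.HomologicalConductor.PersistenceCyclicQuotientAddCover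

end
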